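import Mathlib.Analysis.SpecialFunctions.Pow.Real
import Mathlib.Analysis.SpecialFunctions.Integrals.Basic
import Mathlib.Analysis.Calculus.Deriv.MeanValue
import HarnessLib

/-!
# Yuhjtman's subharmonic majorant `θ` of the Lennard-Jones minus-energy (one-variable facts)

Support file (all results proved) for the discharge of `Yuhjtman2015_minDistance`
(`Yuhjtman2015Proofs.lean`), following S. A. Yuhjtman, *A sensible estimate for the stability
constant of the Lennard-Jones potential*, J. Stat. Phys. 160 (2015) = arXiv:1501.05248, §2–§3.

With the minus-energy `h(r) = -r⁻¹² + 2r⁻⁶` (`hLJ`; §2, "we will work with the minus-energy"),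
`w₀ = (11/5)^{1/6}` (the zero of `Δ h(‖x‖)`, Observation 2), `A = (360/121) w₀`, `B = 25/11`
(Prop. 3: `t(r) = A r⁻¹ - B` "coincides with `h` at `w₀`; the first and second derivatives also
coincide"), the majorant of Prop. 4 is `θ = t` on `(0, w₀]`, `θ = h` on `(w₀, ∞)` (`θ`), and
`θcut m = χ_{[m,∞)} θ` is its truncation (`θ^{0.64}` of Prop. 5 II).

Radial subharmonicity of `Θ(x) = θ(‖x‖)` on `ℝ³ ∖ 0` is the convexity of `g_θ(v) = v θ(v)`
(`Δ Θ = v⁻¹ (v θ)''`); we record it in the form used by the ball mean-value inequality of the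
proofs file: the **midpoint inequality** `g_θ(r+s) + g_θ(r-s) ≥ 2 g_θ(r)` (`two_mul_gθ_le`), from
supporting lines — the tangent `A - B v` of `g = v h(v)` at its inflection point `w₀`
(Prop. 3 (b): `gLJ_le_line`, `line_le_gLJ`) and the tangents of the convex branch `v ≥ w₀`
(`gLJ_tangent_le`). Further: `h ≤ θ`, `0 ≤ θ`, `h ≤ 0` on `(0, 0.89]`, `h ≤ 1`; the numerical
constants: `1.14043 < w₀ < 1.14044`, the value `J = ∫_{0.64}^{R} v² θ ≤ 1.00195` of Prop. 5 II
(printed: `24 J < 24.05`), the polynomial inequality (♣) of its proof for `c = a/2 ∈ [1/4, 0.342]`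
(`clubsuit`), and the final inequality `2a⁶ + 24 J a⁹ < 1` for `a ≤ 0.684` of Cor. 7.
-/

noncomputable section

open Set MeasureTheory intervalIntegral

namespace Literature.MathematicalPhysics.StatisticalMechanics

namespace Yuhjtman2015

/-! ### The constants `w₀ = (11/5)^{1/6}`, `A`, `B` -/

/-- `w₀ = (11/5)^{1/6} ≈ 1.1404`, where `Δ h(‖x‖) = 12(-11 r⁻¹⁴ + 5 r⁻⁸)` changes sign
(Yuhjtman 2015, Observation 2). [cite: Yuhjtman2015, Observation 2] -/
def w₀ : ℝ := (11 / 5 : ℝ) ^ ((6 : ℕ) : ℝ)⁻¹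

/-- `w₀ > 0`. [cite: Yuhjtman2015, Observation 2] -/
theorem w₀_pos : 0 < w₀ := Real.rpow_pos_of_pos (by norm_num) _

/-- `w₀⁶ = 11/5`. [cite: Yuhjtman2015, Observation 2] -/
theorem w₀_pow_six : w₀ ^ 6 = 11 / 5 := Real.rpow_inv_natCast_pow (by norm_num) (by norm_num)

/-- `1.14043 < w₀ < 1.14044`. [cite: Yuhjtman2015, §2] -/
theorem w₀_bounds : (1.14043 : ℝ) < w₀ ∧ w₀ < 1.14044 := by
  constructor
  · refine lt_of_pow_lt_pow_left₀ 6 w₀_pos.le ?_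
    rw [w₀_pow_six]; norm_num
  · refine lt_of_pow_lt_pow_left₀ 6 (by norm_num) ?_
    rw [w₀_pow_six]; norm_num

/-- `w₀⁻¹ = (5/11) w₀⁵`. [cite: Yuhjtman2015, §2] -/
theorem w₀_inv : w₀⁻¹ = 5 / 11 * w₀ ^ 5 := by
  have h := w₀_pow_six
  have h0 := w₀_pos.ne'
  field_simp
  nlinarith [h]

/-- The tangent-line constant `A = (360/121)(11/5)^{1/6}` of `t(r) = A r⁻¹ - B`
(Yuhjtman 2015, Prop. 3). [cite: Yuhjtman2015, Prop. 3] -/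
def A : ℝ := 360 / 121 * w₀

/-- The tangent-line constant `B = 25/11` of `t(r) = A r⁻¹ - B` (Yuhjtman 2015, Prop. 3).
[cite: Yuhjtman2015, Prop. 3] -/
def B : ℝ := 25 / 11

/-- `A > 0`. [cite: Yuhjtman2015, Prop. 3] -/
theorem A_pos : 0 < A := by unfold A; exact mul_pos (by norm_num) w₀_pos

/-- `3.39301 < A < 3.39305`. [cite: Yuhjtman2015, Prop. 3] -/
theorem A_bounds : (3.39301 : ℝ) < A ∧ A < 3.39305 := by
  have := w₀_bounds
  unfold A
  constructor <;> linarith [this.1, this.2]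

/-! ### The minus-energy `h`, `g(v) = v h(v)` and its derivative -/

/-- The Lennard-Jones minus-energy `h(r) = -r⁻¹² + 2 r⁻⁶` in Yuhjtman's normalisation (minimum
`-1` of the potential at distance `1`); `h = -12 · lennardJones`. [cite: Yuhjtman2015, §2] -/
def hLJ (v : ℝ) : ℝ := 2 * v⁻¹ ^ 6 - v⁻¹ ^ 12

/-- `g(v) = v h(v) = 2 v⁻⁵ - v⁻¹¹`; `Δ h(‖x‖) = v⁻¹ g''(v)` in `ℝ³`. [cite: Yuhjtman2015, Observation 2] -/
def gLJ (v : ℝ) : ℝ := 2 * v⁻¹ ^ 5 - v⁻¹ ^ 11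

/-- `g'(v) = 11 v⁻¹² - 10 v⁻⁶`. [cite: Yuhjtman2015, Observation 2] -/
def gLJ' (v : ℝ) : ℝ := 11 * v⁻¹ ^ 12 - 10 * v⁻¹ ^ 6

/-- `v h(v) = g(v)` for `v ≠ 0`. [cite: Yuhjtman2015, §2] -/
theorem mul_hLJ {v : ℝ} (hv : v ≠ 0) : v * hLJ v = gLJ v := by
  unfold hLJ gLJ
  have e6 : v * v⁻¹ ^ 6 = v⁻¹ ^ 5 := by field_simp
  have e12 : v * v⁻¹ ^ 12 = v⁻¹ ^ 11 := by field_simp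
  rw [mul_sub, ← mul_assoc, mul_comm v 2, mul_assoc, e6, e12]

/-- `g` is differentiable away from `0` with derivative `g'`. [folklore] -/
theorem hasDerivAt_gLJ {v : ℝ} (hv : v ≠ 0) : HasDerivAt gLJ (gLJ' v) v := by
  have hi : HasDerivAt (fun y : ℝ ↦ y⁻¹) (-(v ^ 2)⁻¹) v := hasDerivAt_inv hv
  have h := ((hi.fun_pow 5).const_mul 2).fun_sub (hi.fun_pow 11)
  refine h.congr_deriv ?_
  unfold gLJ'
  norm_num
  field_simp
  ring

/-- `g` is continuous on `(0, ∞)`. [folklore] -/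
theorem continuousOn_gLJ : ContinuousOn gLJ (Ioi 0) := fun _ hv ↦
  (hasDerivAt_gLJ (ne_of_gt hv)).continuousAt.continuousWithinAt

/-- **`g' ≥ -B` everywhere**: `11 p² - 10 p + 25/11 = (11 p - 5)²/11 ≥ 0` with `p = v⁻⁶`; this
is why the tangent at the inflection point `w₀` (slope `g'(w₀) = -B`) supports `g_θ`.
[cite: Yuhjtman2015, Prop. 3] -/
theorem neg_B_le_gLJ' (v : ℝ) : -B ≤ gLJ' v := by
  unfold B gLJ'
  have h12 : v⁻¹ ^ 12 = (v⁻¹ ^ 6) ^ 2 := by ring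
  rw [h12]
  nlinarith [sq_nonneg (11 * v⁻¹ ^ 6 - 5)]

/-- `g'(w₀) = -B`. [cite: Yuhjtman2015, Prop. 3 (a)] -/
theorem gLJ'_w₀ : gLJ' w₀ = -B := by
  unfold gLJ' B
  have h6 : w₀⁻¹ ^ 6 = 5 / 11 := by
    rw [inv_pow, w₀_pow_six]; norm_num
  have h12 : w₀⁻¹ ^ 12 = (w₀⁻¹ ^ 6) ^ 2 := by ring
  rw [h12, h6]; norm_num

/-- `g(w₀) = A - B w₀` (the tangent line touches at `w₀`). [cite: Yuhjtman2015, Prop. 3 (a)] -/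
theorem gLJ_w₀ : gLJ w₀ = A - B * w₀ := by
  unfold gLJ A B
  have h5 : w₀⁻¹ ^ 5 = (5 / 11 * w₀ ^ 5) ^ 5 := by rw [w₀_inv]
  have h11 : w₀⁻¹ ^ 11 = (5 / 11 * w₀ ^ 5) ^ 11 := by rw [w₀_inv]
  have h6 := w₀_pow_six
  have e25 : w₀ ^ 25 = (w₀ ^ 6) ^ 4 * w₀ := by ring
  have e55 : w₀ ^ 55 = (w₀ ^ 6) ^ 9 * w₀ := by ring
  rw [h5, h11, mul_pow, mul_pow, ← pow_mul, ← pow_mul, show 5 * 5 = 25 by norm_num,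
    show 5 * 11 = 55 by norm_num, e25, e55, h6]
  norm_num
  ring

/-- `g'` is increasing on `[w₀, ∞)` (`g'' = 12 v⁻¹³ (5v⁶ - 11) ≥ 0` there): with `p = v⁻⁶ ≤ 5/11`,
`g' = 11p² - 10p` is decreasing in `p`. [cite: Yuhjtman2015, Observation 2] -/
theorem gLJ'_mono {r s : ℝ} (hr : w₀ ≤ r) (hrs : r ≤ s) : gLJ' r ≤ gLJ' s := by
  unfold gLJ'
  have hr0 : 0 < r := w₀_pos.trans_le hr
  have hs0 : 0 < s := hr0.trans_le hrs
  set p := r⁻¹ ^ 6 with hp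
  set q := s⁻¹ ^ 6 with hq
  have hr12 : r⁻¹ ^ 12 = p ^ 2 := by rw [hp]; ring
  have hs12 : s⁻¹ ^ 12 = q ^ 2 := by rw [hq]; ring
  rw [hr12, hs12]
  have hq0 : 0 ≤ q := by positivity
  have hqp : q ≤ p := by
    rw [hp, hq]
    exact pow_le_pow_left₀ (by positivity) ((inv_le_inv₀ hs0 hr0).2 hrs) 6
  have hp1 : p ≤ 5 / 11 := by
    have h6 : (11 / 5 : ℝ) ≤ r ^ 6 := by
      rw [← w₀_pow_six]; exact pow_le_pow_left₀ w₀_pos.le hr 6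
    rw [hp, inv_pow, inv_le_comm₀ (by positivity) (by norm_num),
      show ((5 : ℝ) / 11)⁻¹ = 11 / 5 by norm_num]
    exact h6
  nlinarith [mul_nonneg (sub_nonneg.2 hqp) (by linarith : (0 : ℝ) ≤ 10 - 11 * (p + q))]

/-- The gap `ψ(v) = (A - B v) - g(v)` between the tangent line at `w₀` and `g` is decreasing on
`(0, ∞)` (`ψ' = -B - g' ≤ 0`). [cite: Yuhjtman2015, Prop. 3 (b)] -/
theorem antitoneOn_line_sub_gLJ : AntitoneOn (fun v ↦ A - B * v - gLJ v) (Ioi 0) := by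
  have hD : interior (Ioi (0 : ℝ)) = Ioi 0 := interior_Ioi
  refine antitoneOn_of_hasDerivWithinAt_nonpos (convex_Ioi 0) (f' := fun v ↦ -B - gLJ' v)
    ?_ ?_ ?_
  · intro v hv
    exact (((continuousOn_const.sub (continuousOn_const.mul continuousOn_id)).sub
      continuousOn_gLJ) v hv)
  · intro v hv
    rw [hD] at hv ⊢
    have h := ((hasDerivAt_const v A).fun_sub ((hasDerivAt_id' v).const_mul B)).fun_sub
      (hasDerivAt_gLJ (ne_of_gt hv))
    refine (h.congr_deriv ?_).hasDerivWithinAt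
    ring
  · intro v _
    have := neg_B_le_gLJ' v
    linarith

/-- **Prop. 3 (b), left**: `g(v) ≤ A - B v` for `0 < v ≤ w₀` (i.e. `h ≤ t` there).
[cite: Yuhjtman2015, Prop. 3 (b)] -/
theorem gLJ_le_line {v : ℝ} (hv : 0 < v) (hvw : v ≤ w₀) : gLJ v ≤ A - B * v := by
  have h := antitoneOn_line_sub_gLJ hv w₀_pos hvw
  simp only [gLJ_w₀, sub_self] at h
  linarith

/-- **Prop. 3 (b), right**: `A - B v ≤ g(v)` for `w₀ ≤ v` (i.e. `t ≤ h` there).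
[cite: Yuhjtman2015, Prop. 3 (b)] -/
theorem line_le_gLJ {v : ℝ} (hvw : w₀ ≤ v) : A - B * v ≤ gLJ v := by
  have h := antitoneOn_line_sub_gLJ w₀_pos (w₀_pos.trans_le hvw) hvw
  simp only [gLJ_w₀, sub_self] at h
  linarith

/-- **Tangents of the convex branch**: for `r, v ≥ w₀`, `g(r) + g'(r)(v - r) ≤ g(v)` (mean value
theorem and monotonicity of `g'` on `[w₀, ∞)`). [cite: Yuhjtman2015, Observation 2] -/
theorem gLJ_tangent_le {r v : ℝ} (hr : w₀ ≤ r) (hv : w₀ ≤ v) :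
    gLJ r + gLJ' r * (v - r) ≤ gLJ v := by
  have hr0 : 0 < r := w₀_pos.trans_le hr
  have hv0 : 0 < v := w₀_pos.trans_le hv
  rcases lt_trichotomy r v with hlt | rfl | hgt
  · obtain ⟨ξ, hξ, hξ'⟩ := exists_hasDerivAt_eq_slope gLJ gLJ' hlt
      (continuousOn_gLJ.mono fun x hx ↦ hr0.trans_le hx.1)
      (fun x hx ↦ hasDerivAt_gLJ (hr0.trans hx.1).ne')
    have hmono := gLJ'_mono hr hξ.1.le
    rw [hξ'] at hmono
    rw [le_div_iff₀ (by linarith)] at hmono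
    linarith
  · simp
  · obtain ⟨ξ, hξ, hξ'⟩ := exists_hasDerivAt_eq_slope gLJ gLJ' hgt
      (continuousOn_gLJ.mono fun x hx ↦ hv0.trans_le hx.1)
      (fun x hx ↦ hasDerivAt_gLJ (hv0.trans hx.1).ne')
    have hmono := gLJ'_mono (hv.trans hξ.1.le) hξ.2.le
    rw [hξ'] at hmono
    rw [div_le_iff₀ (by linarith)] at hmono
    nlinarith

/-! ### The majorant `θ` and `g_θ(v) = v θ(v)` -/

/-- **Yuhjtman's majorant** `θ = t = A r⁻¹ - B` on `(0, w₀]`, `θ = h` on `(w₀, ∞)`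
(Yuhjtman 2015, Prop. 4; `Θ(x) = θ(‖x‖)` is `C²` and subharmonic on `ℝ³ ∖ 0`).
[cite: Yuhjtman2015, Prop. 4] -/
def θ (v : ℝ) : ℝ := if v ≤ w₀ then A / v - B else hLJ v

/-- The truncated majorant `θ^{m} = χ_{[m,∞)} θ` (Yuhjtman 2015, proof of Prop. 5 II with
`m = 0.64`). [cite: Yuhjtman2015, Prop. 5] -/
def θcut (m v : ℝ) : ℝ := if m ≤ v then θ v else 0

/-- `g_θ(v) = v θ(v)`: the tangent line `A - B v` on `(0, w₀]`, `g` on `(w₀, ∞)`; a convex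
function. [cite: Yuhjtman2015, Prop. 4] -/
def gθ (v : ℝ) : ℝ := v * θ v

/-- `g_θ` on `(0, w₀]`. [cite: Yuhjtman2015, Prop. 4] -/
theorem gθ_of_le {v : ℝ} (hv : 0 < v) (hvw : v ≤ w₀) : gθ v = A - B * v := by
  unfold gθ θ
  rw [if_pos hvw]
  field_simp

/-- `g_θ` on `(w₀, ∞)`. [cite: Yuhjtman2015, Prop. 4] -/
theorem gθ_of_lt {v : ℝ} (hvw : w₀ < v) : gθ v = gLJ v := by
  unfold gθ θ
  rw [if_neg (not_le.2 hvw), mul_hLJ (w₀_pos.trans hvw).ne']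

/-- `g_θ` on `[w₀, ∞)` (the two branches agree at `w₀`). [cite: Yuhjtman2015, Prop. 4] -/
theorem gθ_of_ge {v : ℝ} (hvw : w₀ ≤ v) : gθ v = gLJ v := by
  rcases hvw.eq_or_lt with h | h
  · rw [← h, gθ_of_le w₀_pos le_rfl, gLJ_w₀]
  · exact gθ_of_lt h

/-- **Supporting lines of `g_θ`** (its convexity): at every `r > 0` there is a slope `m` with
`g_θ(r) + m (v - r) ≤ g_θ(v)` for all `v > 0`. [cite: Yuhjtman2015, Prop. 4] -/
theorem exists_support_gθ {r : ℝ} (hr : 0 < r) :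
    ∃ m : ℝ, ∀ v, 0 < v → gθ r + m * (v - r) ≤ gθ v := by
  rcases le_or_gt r w₀ with hrw | hrw
  · refine ⟨-B, fun v hv ↦ ?_⟩
    rw [gθ_of_le hr hrw]
    rcases le_or_gt v w₀ with hvw | hvw
    · rw [gθ_of_le hv hvw]; linarith
    · rw [gθ_of_lt hvw]
      have := line_le_gLJ hvw.le
      linarith
  · refine ⟨gLJ' r, fun v hv ↦ ?_⟩
    rw [gθ_of_lt hrw]
    rcases le_or_gt v w₀ with hvw | hvw
    · rw [gθ_of_le hv hvw]
      have h1 := gLJ_tangent_le hrw.le le_rfl (v := w₀)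
      rw [gLJ_w₀] at h1
      have h2 : gLJ' r * (v - w₀) ≤ -B * (v - w₀) :=
        mul_le_mul_of_nonpos_right (neg_B_le_gLJ' r) (by linarith)
      nlinarith
    · rw [gθ_of_lt hvw]
      exact gLJ_tangent_le hrw.le hvw.le

/-- **Midpoint inequality** (convexity of `g_θ`, i.e. subharmonicity of `θ(‖x‖)`):
`2 g_θ(r) ≤ g_θ(r + s) + g_θ(r - s)` whenever `0 ≤ s < r`. [cite: Yuhjtman2015, Prop. 4] -/
theorem two_mul_gθ_le {r s : ℝ} (hs : 0 ≤ s) (hrs : s < r) :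
    2 * gθ r ≤ gθ (r + s) + gθ (r - s) := by
  obtain ⟨m, hm⟩ := exists_support_gθ (hs.trans_lt hrs)
  have h1 := hm (r + s) (by linarith)
  have h2 := hm (r - s) (by linarith)
  nlinarith

/-! ### Comparisons: `h ≤ θ`, `0 ≤ θ`, `h ≤ 0` near the origin, `h ≤ 1` -/

/-- **`h ≤ θ`** on `(0, ∞)` (Prop. 4: `h̃ ≤ θ` off the unit ball; `h ≤ t` on `(0, w₀]` by
Prop. 3 (b)). [cite: Yuhjtman2015, Prop. 4] -/
theorem hLJ_le_θ {v : ℝ} (hv : 0 < v) : hLJ v ≤ θ v := by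
  unfold θ
  split_ifs with hvw
  · have h := gLJ_le_line hv hvw
    rw [← mul_hLJ hv.ne'] at h
    rw [le_sub_iff_add_le, le_div_iff₀ hv]
    linarith
  · exact le_rfl

/-- `θ ≥ 0` on `(0, ∞)` (indeed `θ > 0`: `t(v) ≥ t(w₀) = 85/121` on `(0, w₀]`, and `h(v) > 0`
for `v⁶ > 1/2`). [cite: Yuhjtman2015, Prop. 4] -/
theorem θ_nonneg {v : ℝ} (hv : 0 < v) : 0 ≤ θ v := by
  unfold θ
  split_ifs with hvw
  · unfold A B
    rw [sub_nonneg, le_div_iff₀ hv]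
    have := w₀_bounds.1
    nlinarith
  · push Not at hvw
    unfold hLJ
    have h6 : v⁻¹ ^ 6 ≤ 5 / 11 := by
      have h : (11 / 5 : ℝ) ≤ v ^ 6 := by
        rw [← w₀_pow_six]; exact pow_le_pow_left₀ w₀_pos.le hvw.le 6
      rw [inv_pow, inv_le_comm₀ (by positivity) (by norm_num),
        show ((5 : ℝ) / 11)⁻¹ = 11 / 5 by norm_num]
      exact h
    have h0 : 0 ≤ v⁻¹ ^ 6 := by positivity
    have h12 : v⁻¹ ^ 12 = (v⁻¹ ^ 6) ^ 2 := by ring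
    rw [h12]
    nlinarith

/-- An upper bound: `θ(v) ≤ A/m` for `v ≥ m`, `0 < m ≤ w₀` (`t` is decreasing, `h ≤ 1 ≤ A/w₀`).
[cite: Yuhjtman2015, Prop. 4] -/
theorem θ_le {m v : ℝ} (hm : 0 < m) (hmw : m ≤ w₀) (hmv : m ≤ v) : θ v ≤ A / m := by
  have hv : 0 < v := hm.trans_le hmv
  unfold θ
  split_ifs with hvw
  · have h1 : A / v ≤ A / m := div_le_div_of_nonneg_left A_pos.le hm hmv
    have h2 : (0 : ℝ) ≤ B := by unfold B; norm_num
    linarith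
  · -- `h(v) ≤ 1 ≤ A / w₀ ≤ A / m`
    have h1 : hLJ v ≤ 1 := by
      unfold hLJ
      have h12 : v⁻¹ ^ 12 = (v⁻¹ ^ 6) ^ 2 := by ring
      rw [h12]
      nlinarith [sq_nonneg (v⁻¹ ^ 6 - 1)]
    have h2 : (1 : ℝ) ≤ A / m := by
      rw [le_div_iff₀ hm]
      have := A_bounds.1
      have := w₀_bounds.2
      linarith
    linarith

/-- `h ≤ 1` everywhere (`h = 1 - (v⁻⁶ - 1)²`). [cite: Yuhjtman2015, §2] -/
theorem hLJ_le_one (v : ℝ) : hLJ v ≤ 1 := by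
  unfold hLJ
  have h12 : v⁻¹ ^ 12 = (v⁻¹ ^ 6) ^ 2 := by ring
  rw [h12]
  nlinarith [sq_nonneg (v⁻¹ ^ 6 - 1)]

/-- `h ≤ 0` on `[0, 0.89]` (`h < 0` iff `v⁶ < 1/2`, and `0.89⁶ < 1/2`; `h(0) = 0` by `0⁻¹ = 0`);
thresholds are written as fractions (`89/100`).
[cite: Yuhjtman2015, §2] -/
theorem hLJ_nonpos {v : ℝ} (hv0 : 0 ≤ v) (hv : v ≤ 89 / 100) : hLJ v ≤ 0 := by
  unfold hLJ
  rcases hv0.eq_or_lt with h | h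
  · rw [← h]; simp
  · have h6 : (2 : ℝ) ≤ v⁻¹ ^ 6 := by
      have hv6 : v ^ 6 ≤ 1 / 2 := (pow_le_pow_left₀ hv0 hv 6).trans (by norm_num)
      rw [inv_pow, le_inv_comm₀ (by norm_num) (by positivity)]
      linarith
    have h12 : v⁻¹ ^ 12 = (v⁻¹ ^ 6) ^ 2 := by ring
    rw [h12]
    nlinarith

/-! ### Measurability and bounds of the truncated majorant -/

/-- `θ` is measurable. [folklore] -/
theorem measurable_θ : Measurable θ := by
  unfold θ hLJ
  refine Measurable.ite measurableSet_Iic ?_ ?_ <;> fun_prop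

/-- `θcut m` is measurable. [folklore] -/
theorem measurable_θcut (m : ℝ) : Measurable (θcut m) := by
  unfold θcut
  exact Measurable.ite measurableSet_Ici measurable_θ measurable_const

/-- `0 ≤ θcut m ≤ A/m` (`0 < m ≤ w₀`). [cite: Yuhjtman2015, Prop. 5] -/
theorem θcut_nonneg {m : ℝ} (hm : 0 < m) (v : ℝ) : 0 ≤ θcut m v := by
  unfold θcut
  split_ifs with h
  · exact θ_nonneg (hm.trans_le h)
  · exact le_rfl

/-- `θcut m ≤ A/m` (`0 < m ≤ w₀`). [cite: Yuhjtman2015, Prop. 5] -/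
theorem θcut_le {m : ℝ} (hm : 0 < m) (hmw : m ≤ w₀) (v : ℝ) : θcut m v ≤ A / m := by
  unfold θcut
  split_ifs with h
  · exact θ_le hm hmw h
  · exact div_nonneg A_pos.le hm.le

/-- `θcut m` is interval integrable on every interval (bounded and measurable). [folklore] -/
theorem intervalIntegrable_θcut {m : ℝ} (hm : 0 < m) (hmw : m ≤ w₀) (a b : ℝ) :
    IntervalIntegrable (θcut m) volume a b := by
  refine (intervalIntegrable_const (c := A / m)).mono_fun
    (measurable_θcut m).aestronglyMeasurable (Filter.Eventually.of_forall fun v ↦ ?_)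
  show ‖θcut m v‖ ≤ ‖A / m‖
  rw [Real.norm_of_nonneg (θcut_nonneg hm v), Real.norm_of_nonneg (div_nonneg A_pos.le hm.le)]
  exact θcut_le hm hmw v

/-- `θcut m = θ` on `[m, ∞)`. [cite: Yuhjtman2015, Prop. 5] -/
theorem θcut_of_le {m v : ℝ} (h : m ≤ v) : θcut m v = θ v := if_pos h

/-- `θcut m = 0` on `(-∞, m)`. [cite: Yuhjtman2015, Prop. 5] -/
theorem θcut_of_lt {m v : ℝ} (h : v < m) : θcut m v = 0 := if_neg (not_le.2 h)

/-! ### Rational data for the numerical inequalities of `Yuhjtman2015Numerics.lean` -/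

/-- A rational lower bound for `A = (360/121) w₀`: `Alo = (360/121) · 1.14043`.
[cite: Yuhjtman2015, Prop. 3] -/
def Alo : ℝ := 360 / 121 * 1.14043

/-- `Alo < A`. [cite: Yuhjtman2015, Prop. 3] -/
theorem Alo_lt_A : Alo < A := by
  unfold Alo A
  have := w₀_bounds.1
  linarith

/-- The polynomial `∫_{0.64}^{1.14} (Alo - B v)(c² - (v-r)²) dv - (4/3) c³ r` of the inequality
(♣) in the proof of Prop. 5 II (with `A` replaced by `Alo`; coefficients in exact rational
arithmetic, `0.64 = 16/25`, `1.14 = 57/50`). [cite: Yuhjtman2015, Prop. 5 II] -/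
def Gpoly (c r : ℝ) : ℝ :=
  51814 / 75625 * c ^ 2 - 51814 / 75625 * r ^ 2 + 106377829 / 90750000 * r
    - 1557379151 / 3025000000 - 4 / 3 * c ^ 3 * r

end Yuhjtman2015

end Literature.MathematicalPhysics.StatisticalMechanics

end
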